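import Summits.ABC.ABC.Theses.DefiniteXi
import Literature.NumberTheory.EllipticCurves.TakahashiRankOneOfEichlerSelberg
import Literature.NumberTheory.EllipticCurves.EichlerSelbergTraceWeightTwoSquarefree

/-!
# STUB-IDEAS k1 companion — `stub_brandtEigenLatticeRankOne` closes from the tree (Plan A, checked)

Crux stmt-ABC-15023 `DefiniteXi.EisensteinQuarantine`, line `forced-pair-dlog`; stub = item stmt-ABC-17203 =
named fact `takahashi2001_brandtEigenLattice_rank_one` (defeq).  Composition of two LANDED Literature theorems:
`takahashi2001_brandtEigenLattice_rank_one_of_cuspidalHeckeTrace_eq` (TakahashiRankOneOfEichlerSelberg, 2026-08-17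
11:39Z) and `ModularForms.cuspidalHeckeTrace_eq_geometricSide` (EichlerSelbergTraceWeightTwoSquarefree, 16:50Z).
Farm check 17:48Z: rc 0, 0 sorries, axioms [propext, Classical.choice, Quot.sound], audit proof-of-item closed=true.
This file is EVIDENCE (planner stub-ideation may not propose); a prover lands it as described in
`STUB-IDEAS-stub_brandtEigenLatticeRankOne-1.md` (Plan A landing recipe 1–3). -/

namespace Summit.ABC.ABC.Cruxes.EisensteinQuarantine.StubIdeasK1

open Literature.NumberTheory.EllipticCurves
open Literature.NumberTheory.EllipticCurves.ModularForms

/-- H0: the crux decl is definitionally the named fact (grounder: Iff.rfl). -/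
theorem brandtEigenLatticeRankOne_iff_fact :
    Summit.ABC.ABC.Theses.DefiniteXi.BrandtEigenLatticeRankOne ↔
      takahashi2001_brandtEigenLattice_rank_one := Iff.rfl

/-- H1: the Eichler–Selberg input in exactly the shape the landed reduction consumes. -/
theorem eichlerSelberg_squarefree_coprime :
    ∀ (N : ℕ) [NeZero N], Squarefree N →
      ∀ n : ℕ, 0 < n → n.Coprime N →
        Literature.NumberTheory.Automorphic.HeckeTraceFormulaGL2Level.cuspidalHeckeTrace N 2 1 n =
          Literature.NumberTheory.Automorphic.HeckeTraceFormulaGL2Level.geometricSide N 1 2 n :=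
  fun _ _ hN _ hn hnN => cuspidalHeckeTrace_eq_geometricSide hN hn hnN

/-- The registered stub, verbatim name + signature, closed by composition. -/
theorem stub_brandtEigenLatticeRankOne :
    Summit.ABC.ABC.Theses.DefiniteXi.BrandtEigenLatticeRankOne :=
  takahashi2001_brandtEigenLattice_rank_one_of_cuspidalHeckeTrace_eq
    eichlerSelberg_squarefree_coprime

end Summit.ABC.ABC.Cruxes.EisensteinQuarantine.StubIdeasK1
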